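import Literature.NumberTheory.LFunctions.BurnolHardyRightTools
import Literature.NumberTheory.LFunctions.BurnolDilationCriterionProofs
import Literature.Analysis.FunctionSpaces.PlancherelL1L2
import Literature.NumberTheory.LFunctions.ZetaZerosReflection
import HarnessLib

/-!
# `((s−1)/s)·ζ(s)/s ∈ ℍ²(Re s > 1/2)` — the analytic input of Burnol 2004b, Prop. 4.2

LINE 1 — LABEL: RH-FREE (a Hardy-space membership of an explicit function built from `ζ`; no
hypothesis and no conclusion about the zeros). FRAMING (cell rh-crit, D-0074): corpus theorems are
RH-FREE literature; nothing here is worded as progress toward RH. bears_on: B-C/B-P (LADDER-RH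
COLUMN 6, de Branges framework) as infrastructure for the as-printed discharge of
`Burnol2004b_prop4_2` (`ζ(s)/(s−ρ)^l ∈ L̂₁`). WHAT THIS IS NOT: not Prop. 4.2 itself — the passage
from `ℍ²`-membership to `L̂₁`-membership is Prop. 4.1 (ii) = the Paley–Wiener theorem for `ℍ²`,
which is NOT proved here; not a route, not a criterion; nothing here bears on the truth of RH.

Burnol (proof of Prop. 4.2, TeX l.695–707): "we only need to prove that
`((s−1)/s)F(s) = ((s−1)/s)ζ(s)/(s−ρ)^l` belongs to `ℍ²`. This is well-known to be true of
`((s−1)/s)ζ(s)/s` (from the formula `ζ(s)/s = 1/(s−1) − ∫₁^∞ {t}t^{−s−1} dt`, valid for `0 < Re(s)`),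
hence it holds also for `((s−1)/s)ζ(s)/s^l`." This module proves exactly these two memberships, in the
`t`-picture already in the tree: `((s−1)/s)·ζ(s)/s = Â(s)`, the Mellin transform of Burnol's
`A(u) = [1/u] log u + log([1/u]!) + [1/u]` on `(0,1]` (`Burnol2001.hasMellin_fnA`,
[Burnol2001, §2]); `A = O(u^{−1/4})` at `0⁺` by Stirling's bounds, so `Â` is holomorphic on
`Re s > 1/4` (Mathlib `mellin_differentiableAt_of_isBigO_rpow`) and Mellin–Plancherel
(`Literature.Analysis.FunctionSpaces.integral_norm_sq_mellin_eq`) bounds its `L²` norms on the lines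
`Re s = σ > 1/2` by `2π ∫₀^1 |A|² u^{2σ−1} du ≤ 36π`.

POLE-TOLERANT PHRASING. The literal function `s ↦ ((s−1)/s)ζ(s)/s` has a removable singularity at
`s = 1` where its Lean value is `0 ≠ 1 = lim`; `IsHardyRight` (holomorphy on the open half-plane)
is therefore stated for a function `F ∈ ℍ²` AGREEING with it on `Re s > 1/2, s ≠ 1` (here `F = Â`).

## Main results (all PROVED; no definition, no named fact)

* `BurnolZetaHardy.fnA_bounds`, `norm_fnA_le` — `−1 ≤ A(u) ≤ 1 + ½ log(1/u)`, `|A(u)| ≤ 3u^{−1/4}`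
  on `(0,1]` (Stirling's bounds for `log N!`, the upper one from the monotone Stirling sequence).
* `BurnolZetaHardy.integrableOn_fnA`, `mellinConvergent_fnA`, `differentiableAt_mellin_fnA`
  (`Re s > 1/4`), `integral_normSq_fnA_le` (`∫₀^∞ |A|² u^{2σ−1} ≤ 18`, `σ ≥ 1/2`).
* `BurnolZetaHardy.isHardyRight_mellin_fnA` — `Â ∈ ℍ²(Re s > 1/2)`.
* `BurnolZetaHardy.mellin_fnA_eq` — `Â(s) = (s−1)ζ(s)/s²` on `Re s > 1/2`, `s ≠ 1` (identity theorem
  from the strip `1/2 < Re s < 1`, where it is `Burnol2001.hasMellin_fnA`).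
* `BurnolZetaHardy.exists_isHardyRight_zeta_div`, `exists_isHardyRight_zeta_div_pow` — there is
  `F ∈ ℍ²` with `F(s) = ((s−1)/s)·ζ(s)/s^l` on `Re s > 1/2`, `s ≠ 1` (`l ≥ 1`).

* `BurnolZetaHardy.analyticAt_zetaOverPow`, `differentiableOn_zetaOverPow` — `zetaOverPow ρ l`
  (`ζ(s)/(s−ρ)^l` filled in at `ρ` by `ζ^{(l)}(ρ)/l!`) is holomorphic on `ℂ ∖ {1}` when
  `l ≤ analyticOrderAt ζ ρ`, `ρ ≠ 1` (factorisation `ζ = (z−ρ)^l·g` and `ζ^{(l)}(ρ) = l!·g(ρ)`).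
* `BurnolZetaHardy.exists_isHardyRight_zetaOverPow` — for `0 < Re ρ < 1` and `1 ≤ l ≤` the order of
  `ζ` at `ρ`: there is `G ∈ ℍ²` with `G(s) = ((s−1)/s)·ζ(s)/(s−ρ)^l` on `Re s > 1/2`, `s ≠ 1` — the full
  `ℍ²` half of the printed proof of Prop. 4.2 (`IsHardyRight.of_le_off_rect'` on the rectangle
  `[Re ρ/2, (Re ρ+1)/2] × [−|Im ρ|−1, |Im ρ|+1]`, which avoids `0` and `1`).

* `BurnolZetaHardy.Gammaℝ_mul_zetaOverPow_reflect` — the "Fourier transform" side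
  `χ(s)F(1−s) = (−1)^l ζ(s)/(s−(1−ρ))^l` (TeX l.697) in the `Γ_ℝ` form of `Burnol2004b_prop4_1R` (ii):
  `Γ_ℝ(s)·(−1)^l ζ(s)/(s−(1−ρ))^l = Γ_ℝ(1−s)·ζ(1−s)/(1−s−ρ)^l` off the Gamma poles (through
  `Λ(s) = Λ(1−s)`; at `s = 1−ρ` by continuity).
* `BurnolZetaHardy.Burnol2004b_prop4_2_of_prop4_1R_ii` (clause (ii) of `Burnol2004b_prop4_1R` alone
  ⟹ `Burnol2004b_prop4_2`) and `Burnol2004b_prop4_2_of_prop4_1R : Burnol2004b_prop4_1R →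
  Burnol2004b_prop4_2` — the printed proof of Prop. 4.2 assembled; the remaining input is Prop. 4.1
  (ii) (Paley–Wiener in Mellin coordinates), NOT proved here.

## References

* J.-F. Burnol, *Two complete and minimal systems associated with the zeros of the Riemann zeta
  function*, J. Théor. Nombres Bordeaux 16 (2004) 65–94 = arXiv:math/0203120v7, Prop. 4.2 and its
  proof (TeX of record `dbl/src/Burnol2004JTNB_arXivmath0203120v7.tex`, l.688–707). [key `Burnol2004b`]
* J.-F. Burnol, *An adelic causality problem related to abelian L-functions*, J. Number Theory 87
  (2001) = arXiv:math/9912174, §2 (the function `A`, before Thm. 2.4). [key `Burnol2001`]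
* W. Rudin, *Real and Complex Analysis*, 3rd ed., Ch. 19 (Hardy spaces), Ch. 10. [key `Rudin1987`]
-/

noncomputable section

open MeasureTheory Complex Filter Set Asymptotics Real
open scoped Topology

namespace Literature.NumberTheory.LFunctions

namespace BurnolZetaHardy

open Burnol2001

/-! ## Bounds for Burnol's `A(u) = [1/u] log u + log([1/u]!) + [1/u]` -/

/-- Upper Stirling bound `log N! ≤ N log N − N + (log N)/2 + 1` (`N ≥ 1`), from the monotonicity of
Mathlib's Stirling sequence (`stirlingSeq (n+1)` decreases from `e/√2`). [folklore] -/
private theorem log_factorial_le {N : ℕ} (hN : 1 ≤ N) :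
    Real.log (N.factorial : ℝ) ≤ N * Real.log N - N + Real.log N / 2 + 1 := by
  obtain ⟨n, rfl⟩ : ∃ n, N = n + 1 := ⟨N - 1, by omega⟩
  have hanti := Stirling.log_stirlingSeq'_antitone (Nat.zero_le n)
  simp only [Function.comp_apply, Nat.succ_eq_add_one, zero_add] at hanti
  rw [Stirling.stirlingSeq_one, Real.log_div (by positivity) (by positivity), Real.log_exp,
    Stirling.log_stirlingSeq_formula] at hanti
  have hN0 : (0 : ℝ) < (n + 1 : ℕ) := by positivity
  rw [Real.log_mul (by norm_num) hN0.ne', Real.log_div hN0.ne' (Real.exp_pos 1).ne',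
    Real.log_exp] at hanti
  have hsqrt : Real.log (√2) = Real.log 2 / 2 := by
    rw [Real.sqrt_eq_rpow, Real.log_rpow (by norm_num)]; ring
  rw [hsqrt] at hanti
  linarith

/-- **Two-sided bound for `A` on `(0,1]`**: `−1 ≤ A(u) ≤ 1 + (1/2) log(1/u)` (Stirling's bounds for
`log N!`, `N = [1/u] ≥ 1`, and `N log(Nu) ∈ (N − 1/u, 0] ⊂ (−1, 0]`).
[cite: Burnol2001, §2 (before Thm 2.4), TeX l.396–400] -/
theorem fnA_bounds {u : ℝ} (hu : 0 < u) (hu1 : u ≤ 1) :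
    -1 ≤ (fnA u).re ∧ (fnA u).re ≤ 1 + Real.log (1 / u) / 2 := by
  set N : ℕ := ⌊1 / u⌋₊ with hN
  have h1u : 1 ≤ 1 / u := by rw [le_div_iff₀ hu]; linarith
  have hN1 : 1 ≤ N := by rw [hN]; exact Nat.one_le_floor_iff _ |>.2 h1u
  have hNr : (1 : ℝ) ≤ N := by exact_mod_cast hN1
  have hN0 : (0 : ℝ) < N := by linarith
  have hNle : (N : ℝ) ≤ 1 / u := Nat.floor_le (by positivity)
  have hNlt : 1 / u < N + 1 := Nat.lt_floor_add_one _
  have hre : (fnA u).re = N * Real.log u + Real.log (N.factorial : ℝ) + N := by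
    rw [fnA, Complex.ofReal_re]
  rw [hre]
  have hNu1 : (N : ℝ) * u ≤ 1 := by rwa [← le_div_iff₀ hu]
  have hNu0 : 0 < (N : ℝ) * u := by positivity
  have hlogNu : Real.log ((N : ℝ) * u) = Real.log N + Real.log u :=
    Real.log_mul hN0.ne' hu.ne'
  -- `N log(Nu) > -1`
  have hlow : -1 < (N : ℝ) * (Real.log N + Real.log u) := by
    have h1 := Real.one_sub_inv_le_log_of_pos hNu0
    rw [hlogNu] at h1
    have h2 : (N : ℝ) * (1 - ((N : ℝ) * u)⁻¹) = N - 1 / u := by field_simp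
    have h3 : (N : ℝ) - 1 / u > -1 := by linarith
    nlinarith [h1, hN0, h2, h3]
  -- `N log(Nu) ≤ 0`
  have hup : (N : ℝ) * (Real.log N + Real.log u) ≤ 0 := by
    have : Real.log ((N : ℝ) * u) ≤ 0 := Real.log_nonpos hNu0.le hNu1
    rw [hlogNu] at this
    exact mul_nonpos_of_nonneg_of_nonpos hN0.le this
  have hlogN0 : 0 ≤ Real.log (N : ℝ) := Real.log_nonneg hNr
  have hlogNle : Real.log (N : ℝ) ≤ Real.log (1 / u) := Real.log_le_log hN0 hNle
  constructor
  · have hst := Stirling.le_log_factorial_stirling (n := N) (by omega)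
    have h2π : 0 ≤ Real.log (2 * π) / 2 := by
      have : (1 : ℝ) ≤ 2 * π := by linarith [Real.pi_gt_three]
      have := Real.log_nonneg this; positivity
    nlinarith [hst, hlow, hlogN0, h2π]
  · have hst := log_factorial_le hN1
    nlinarith [hst, hup, hlogNle]

/-- `A` is real-valued. [cite: Burnol2001, §2 (before Thm 2.4)] -/
theorem fnA_im (u : ℝ) : (fnA u).im = 0 := by rw [fnA, Complex.ofReal_im]

/-- **`|A(u)| ≤ 3 u^{−1/4}` on `(0,1]`** (from `|A(u)| ≤ 1 + (1/2)log(1/u)` and `log x ≤ 4 x^{1/4}`).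
[cite: Burnol2001, §2 (before Thm 2.4)] -/
theorem norm_fnA_le {u : ℝ} (hu : 0 < u) (hu1 : u ≤ 1) : ‖fnA u‖ ≤ 3 * u ^ (-(1 / 4 : ℝ)) := by
  obtain ⟨h1, h2⟩ := fnA_bounds hu hu1
  have hnorm : ‖fnA u‖ = |(fnA u).re| := by
    rw [← Complex.abs_re_eq_norm.2 (fnA_im u)]
  rw [hnorm]
  have hlog : Real.log (1 / u) ≤ (1 / u) ^ (1 / 4 : ℝ) / (1 / 4) :=
    Real.log_le_rpow_div (by positivity) (by norm_num)
  have hpow : (1 / u) ^ (1 / 4 : ℝ) = u ^ (-(1 / 4 : ℝ)) := by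
    rw [one_div, Real.inv_rpow hu.le, Real.rpow_neg hu.le]
  rw [hpow] at hlog
  have hone : (1 : ℝ) ≤ u ^ (-(1 / 4 : ℝ)) := by
    rw [Real.rpow_neg hu.le]
    exact one_le_inv_iff₀.2 ⟨Real.rpow_pos_of_pos hu _, Real.rpow_le_one hu.le hu1 (by norm_num)⟩
  rw [abs_le]
  constructor <;> nlinarith [h1, h2, hlog, hone]

/-! ## Integrability and the Mellin transform of `A` on `Re s > 1/4` -/

/-- `A = O(u^{−1/4})` at `0⁺`. [cite: Burnol2001, §2 (before Thm 2.4)] -/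
theorem fnA_isBigO_nhds_zero : fnA =O[𝓝[>] 0] (fun u : ℝ ↦ u ^ (-(1 / 4 : ℝ))) := by
  refine IsBigO.of_bound 3 ?_
  filter_upwards [Ioc_mem_nhdsGT (zero_lt_one' ℝ)] with u hu
  rw [Real.norm_of_nonneg (Real.rpow_nonneg hu.1.le _)]
  exact norm_fnA_le hu.1 hu.2

/-- `A` vanishes eventually at `+∞` (on `(1, ∞)`). [cite: Burnol2001, §2 (before Thm 2.4)] -/
theorem fnA_eventuallyEq_zero : fnA =ᶠ[atTop] (fun _ ↦ 0) := by
  filter_upwards [eventually_gt_atTop 1] with u hu using fnA_eq_zero_of_one_lt hu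

/-- `A = O(u^{−a})` at `+∞` for every `a` (it vanishes there). [cite: Burnol2001, §2 (before Thm 2.4)] -/
theorem fnA_isBigO_atTop (a : ℝ) : fnA =O[atTop] (fun u : ℝ ↦ u ^ (-a)) :=
  ((isBigO_zero (fun u : ℝ ↦ u ^ (-a)) atTop).congr' fnA_eventuallyEq_zero.symm
    EventuallyEq.rfl)

/-- `u^{−1/2}` is integrable on `(0,1]`. [folklore] -/
private theorem integrableOn_rpow_neg_half : IntegrableOn (fun u : ℝ ↦ u ^ (-(1 / 2 : ℝ))) (Ioc 0 1) := by
  have h := (intervalIntegral.integrableOn_Ioo_rpow_iff (zero_lt_one' ℝ)).2 (by norm_num : (-1 : ℝ) < -(1 / 2))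
  exact h.congr_set_ae Ioo_ae_eq_Ioc.symm

/-- `u^{−1/4}` is integrable on `(0,1]`. [folklore] -/
private theorem integrableOn_rpow_neg_quarter :
    IntegrableOn (fun u : ℝ ↦ u ^ (-(1 / 4 : ℝ))) (Ioc 0 1) := by
  have h := (intervalIntegral.integrableOn_Ioo_rpow_iff (zero_lt_one' ℝ)).2 (by norm_num : (-1 : ℝ) < -(1 / 4))
  exact h.congr_set_ae Ioo_ae_eq_Ioc.symm

/-- **`A ∈ L¹(0, ∞)`.** [cite: Burnol2001, §2 (before Thm 2.4)] -/
theorem integrableOn_fnA : IntegrableOn fnA (Ioi 0) := by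
  rw [← Ioc_union_Ioi_eq_Ioi zero_le_one]
  refine IntegrableOn.union ?_ ?_
  · refine Integrable.mono' (integrableOn_rpow_neg_quarter.const_mul 3)
      measurable_fnA.aestronglyMeasurable ?_
    refine (ae_restrict_iff' measurableSet_Ioc).2 (Eventually.of_forall fun u hu ↦ ?_)
    exact norm_fnA_le hu.1 hu.2
  · refine integrableOn_zero.congr_fun (fun u hu ↦ ?_) measurableSet_Ioi
    exact (fnA_eq_zero_of_one_lt hu).symm

/-- `A` is locally integrable on `(0, ∞)`. [cite: Burnol2001, §2 (before Thm 2.4)] -/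
theorem locallyIntegrableOn_fnA : LocallyIntegrableOn fnA (Ioi 0) :=
  integrableOn_fnA.locallyIntegrableOn

/-- The Mellin transform of `A` converges absolutely for `Re s > 1/4`.
[cite: Burnol2001, §2 (before Thm 2.4)] -/
theorem mellinConvergent_fnA {s : ℂ} (hs : 1 / 4 < s.re) : MellinConvergent fnA s :=
  mellinConvergent_of_isBigO_rpow locallyIntegrableOn_fnA (fnA_isBigO_atTop (s.re + 1))
    (by linarith) fnA_isBigO_nhds_zero hs

/-- The Mellin transform `s ↦ ∫₀^∞ A(u)u^{s−1} du` is holomorphic on `Re s > 1/4`.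
[cite: Burnol2001, §2 (before Thm 2.4)] -/
theorem differentiableAt_mellin_fnA {s : ℂ} (hs : 1 / 4 < s.re) :
    DifferentiableAt ℂ (mellin fnA) s :=
  mellin_differentiableAt_of_isBigO_rpow locallyIntegrableOn_fnA (fnA_isBigO_atTop (s.re + 1))
    (by linarith) fnA_isBigO_nhds_zero hs

/-- The weighted square integral of `A`: `∫₀^∞ ‖A(u)‖² u^{2σ−1} du ≤ 18` for `σ ≥ 1/2`
(`‖A‖² u^{2σ−1} ≤ 9u^{−1/2}` on `(0,1]`, `0` beyond). [cite: Burnol2001, §2 (before Thm 2.4)] -/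
theorem integral_normSq_fnA_le {σ : ℝ} (hσ : 1 / 2 ≤ σ) :
    IntegrableOn (fun u : ℝ ↦ ‖fnA u‖ ^ 2 * u ^ (2 * σ - 1)) (Ioi 0) ∧
      ∫ u in Ioi 0, ‖fnA u‖ ^ 2 * u ^ (2 * σ - 1) ≤ 18 := by
  have hmeas : AEStronglyMeasurable (fun u : ℝ ↦ ‖fnA u‖ ^ 2 * u ^ (2 * σ - 1)) volume := by
    refine ((continuous_norm.measurable.comp measurable_fnA).pow_const 2).mul ?_
      |>.aestronglyMeasurable
    exact Measurable.pow_const measurable_id _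
  -- pointwise bound on `(0,1]`
  have hpt : ∀ u ∈ Ioc (0 : ℝ) 1, ‖fnA u‖ ^ 2 * u ^ (2 * σ - 1) ≤ 9 * u ^ (-(1 / 2 : ℝ)) := by
    intro u hu
    have h1 := norm_fnA_le hu.1 hu.2
    have h2 : ‖fnA u‖ ^ 2 ≤ (3 * u ^ (-(1 / 4 : ℝ))) ^ 2 := pow_le_pow_left₀ (norm_nonneg _) h1 2
    have h3' : (u ^ (-(1 / 4 : ℝ))) ^ 2 = u ^ (-(1 / 2 : ℝ)) := by
      rw [← Real.rpow_natCast, ← Real.rpow_mul hu.1.le]; norm_num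
    have h3 : (3 * u ^ (-(1 / 4 : ℝ))) ^ 2 = 9 * u ^ (-(1 / 2 : ℝ)) := by
      rw [mul_pow, h3']; norm_num
    have h4 : u ^ (2 * σ - 1) ≤ 1 := Real.rpow_le_one hu.1.le hu.2 (by linarith)
    have h5 : 0 ≤ u ^ (2 * σ - 1) := Real.rpow_nonneg hu.1.le _
    calc ‖fnA u‖ ^ 2 * u ^ (2 * σ - 1) ≤ (9 * u ^ (-(1 / 2 : ℝ))) * 1 := by
          rw [← h3]; exact mul_le_mul h2 h4 h5 (by positivity)
      _ = 9 * u ^ (-(1 / 2 : ℝ)) := mul_one _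
  have hzero : ∀ u ∈ Ioi (1 : ℝ), ‖fnA u‖ ^ 2 * u ^ (2 * σ - 1) = 0 := fun u hu ↦ by
    rw [fnA_eq_zero_of_one_lt hu]; simp
  have hint1 : IntegrableOn (fun u : ℝ ↦ ‖fnA u‖ ^ 2 * u ^ (2 * σ - 1)) (Ioc 0 1) := by
    refine Integrable.mono' (integrableOn_rpow_neg_half.const_mul 9) hmeas.restrict ?_
    refine (ae_restrict_iff' measurableSet_Ioc).2 (Eventually.of_forall fun u hu ↦ ?_)
    have hu0 : 0 < u := hu.1
    rw [Real.norm_of_nonneg (by positivity)]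
    exact hpt u hu
  have hint2 : IntegrableOn (fun u : ℝ ↦ ‖fnA u‖ ^ 2 * u ^ (2 * σ - 1)) (Ioi 1) :=
    integrableOn_zero.congr_fun (fun u hu ↦ (hzero u hu).symm) measurableSet_Ioi
  have hint : IntegrableOn (fun u : ℝ ↦ ‖fnA u‖ ^ 2 * u ^ (2 * σ - 1)) (Ioi 0) := by
    rw [← Ioc_union_Ioi_eq_Ioi zero_le_one]; exact hint1.union hint2
  refine ⟨hint, ?_⟩
  rw [← Ioc_union_Ioi_eq_Ioi zero_le_one,
    setIntegral_union (Ioc_disjoint_Ioi_same (a := (0 : ℝ)) (b := 1)) measurableSet_Ioi hint1 hint2,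
    setIntegral_eq_zero_of_forall_eq_zero hzero, add_zero]
  calc ∫ u in Ioc (0 : ℝ) 1, ‖fnA u‖ ^ 2 * u ^ (2 * σ - 1)
      ≤ ∫ u in Ioc (0 : ℝ) 1, 9 * u ^ (-(1 / 2 : ℝ)) :=
        setIntegral_mono_on hint1 (integrableOn_rpow_neg_half.const_mul 9) measurableSet_Ioc hpt
    _ = 9 * ∫ u in (0 : ℝ)..1, u ^ (-(1 / 2 : ℝ)) := by
        rw [integral_const_mul, intervalIntegral.integral_of_le zero_le_one]
    _ = 18 := by
        rw [integral_rpow (Or.inl (by norm_num))]; norm_num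

/-! ## `Â ∈ ℍ²(Re s > 1/2)` and `Â(s) = (s−1)ζ(s)/s²` there -/

/-- **The Mellin transform of `A` lies in `ℍ²(Re s > 1/2)`** (holomorphic on `Re s > 1/4`; on the
line `Re s = σ ≥ 1/2` Mellin–Plancherel gives `∫ |Â(σ+iτ)|² dτ = 2π ∫₀^1 |A(u)|² u^{2σ−1} du ≤ 36π`).
This is the statement "`((s−1)/s)·ζ(s)/s` belongs to `ℍ²` … from the formula
`ζ(s)/s = 1/(s−1) − ∫₁^∞ {t} t^{−s−1} dt`", in the `t`-picture of [Burnol2001].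
[cite: Burnol2004b, Prop. 4.2, proof (arXiv:math/0203120v7 p. 8, TeX l.698–701)] -/
theorem isHardyRight_mellin_fnA : IsHardyRight (mellin fnA) := by
  have hdiff : DifferentiableOn ℂ (mellin fnA) {s | 1 / 2 < s.re} := fun s hs ↦
    (differentiableAt_mellin_fnA (by simp only [Set.mem_setOf_eq] at hs; linarith)).differentiableWithinAt
  refine ⟨hdiff, 36 * π, fun σ hσ ↦ ?_⟩
  have hconv : MellinConvergent fnA (σ : ℂ) :=
    mellinConvergent_fnA (by rw [Complex.ofReal_re]; linarith)
  obtain ⟨hint2, hle⟩ := integral_normSq_fnA_le hσ.le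
  obtain ⟨hI, heq⟩ := Literature.Analysis.FunctionSpaces.integral_norm_sq_mellin_eq hconv hint2
  have hcont : Continuous (fun τ : ℝ ↦ mellin fnA (σ + τ * I)) :=
    IsHardyRight.continuous_line hdiff hσ
  refine ⟨(memLp_two_iff_integrable_sq_norm hcont.aestronglyMeasurable).2 hI, ?_⟩
  rw [heq]
  have hπ : 0 < π := Real.pi_pos
  nlinarith [hle, hπ]

/-- `Â(s) = (s−1)ζ(s)/s²` on the open strip `1/2 < Re s < 1` (`hasMellin_fnA`).
[cite: Burnol2001, §2 (before Thm 2.4), TeX l.396–400] -/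
theorem mellin_fnA_eq_of_mem_strip {s : ℂ} (hs : 1 / 2 < s.re) (hs1 : s.re < 1) :
    mellin fnA s = (s - 1) * riemannZeta s / s ^ 2 :=
  (hasMellin_fnA (by linarith) hs1).2

/-- The slit half-plane `{Re s > 1/2} ∖ {1}`, written as a union of four convex pieces, is
preconnected. [folklore] -/
private theorem isPreconnected_halfPlane_diff_one :
    IsPreconnected ({s : ℂ | 1 / 2 < s.re ∧ s.re < 1} ∪ {s : ℂ | 1 / 2 < s.re ∧ 0 < s.im} ∪
      {s : ℂ | 1 / 2 < s.re ∧ s.im < 0} ∪ {s : ℂ | 1 < s.re}) := by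
  have h1 : IsPreconnected {s : ℂ | 1 / 2 < s.re ∧ s.re < 1} :=
    (convex_halfSpace_re_gt (1 / 2)).inter (convex_halfSpace_re_lt 1) |>.isPreconnected
  have h2 : IsPreconnected {s : ℂ | 1 / 2 < s.re ∧ 0 < s.im} :=
    (convex_halfSpace_re_gt (1 / 2)).inter (convex_halfSpace_im_gt 0) |>.isPreconnected
  have h3 : IsPreconnected {s : ℂ | 1 / 2 < s.re ∧ s.im < 0} :=
    (convex_halfSpace_re_gt (1 / 2)).inter (convex_halfSpace_im_lt 0) |>.isPreconnected
  have h4 : IsPreconnected {s : ℂ | 1 < s.re} := (convex_halfSpace_re_gt 1).isPreconnected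
  have h12 := IsPreconnected.union (3 / 4 + I) (by simp; norm_num) (by simp; norm_num) h1 h2
  have h123 := IsPreconnected.union (3 / 4 - I) (by simp; norm_num) (by simp; norm_num) h12 h3
  exact IsPreconnected.union (2 + I) (by simp; norm_num) (by simp) h123 h4

/-- **`Â(s) = (s−1)ζ(s)/s²` on the whole slit half-plane `Re s > 1/2`, `s ≠ 1`** (identity theorem:
both sides are holomorphic there and agree on the strip).
[cite: Burnol2004b, Prop. 4.2, proof (arXiv:math/0203120v7 p. 8, TeX l.698–701)] -/
theorem mellin_fnA_eq {s : ℂ} (hs : 1 / 2 < s.re) (hs1 : s ≠ 1) :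
    mellin fnA s = (s - 1) * riemannZeta s / s ^ 2 := by
  set V : Set ℂ := {s : ℂ | 1 / 2 < s.re ∧ s.re < 1} ∪ {s : ℂ | 1 / 2 < s.re ∧ 0 < s.im} ∪
      {s : ℂ | 1 / 2 < s.re ∧ s.im < 0} ∪ {s : ℂ | 1 < s.re} with hV
  have hVsub : ∀ z ∈ V, 1 / 2 < z.re ∧ z ≠ 1 := by
    intro z hz
    simp only [hV, Set.mem_union, Set.mem_setOf_eq] at hz
    rcases hz with ((⟨h1, h2⟩ | ⟨h1, h2⟩) | ⟨h1, h2⟩) | h1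
    · exact ⟨h1, fun h ↦ by simp [h] at h2⟩
    · exact ⟨h1, fun h ↦ by simp [h] at h2⟩
    · exact ⟨h1, fun h ↦ by simp [h] at h2⟩
    · exact ⟨by linarith, fun h ↦ by simp [h] at h1⟩
  have hsV : s ∈ V := by
    simp only [hV, Set.mem_union, Set.mem_setOf_eq]
    rcases lt_trichotomy s.re 1 with h | h | h
    · exact Or.inl (Or.inl (Or.inl ⟨hs, h⟩))
    · rcases lt_trichotomy s.im 0 with hi | hi | hi
      · exact Or.inl (Or.inr ⟨hs, hi⟩)
      · exact absurd (Complex.ext (by simpa using h) (by simpa using hi)) hs1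
      · exact Or.inl (Or.inl (Or.inr ⟨hs, hi⟩))
    · exact Or.inr h
  have hVopen : IsOpen V := by
    have ho1 : IsOpen {s : ℂ | 1 / 2 < s.re ∧ s.re < 1} :=
      (isOpen_lt continuous_const Complex.continuous_re).inter
        (isOpen_lt Complex.continuous_re continuous_const)
    have ho2 : IsOpen {s : ℂ | 1 / 2 < s.re ∧ 0 < s.im} :=
      (isOpen_lt continuous_const Complex.continuous_re).inter
        (isOpen_lt continuous_const Complex.continuous_im)
    have ho3 : IsOpen {s : ℂ | 1 / 2 < s.re ∧ s.im < 0} :=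
      (isOpen_lt continuous_const Complex.continuous_re).inter
        (isOpen_lt Complex.continuous_im continuous_const)
    have ho4 : IsOpen {s : ℂ | 1 < s.re} := isOpen_lt continuous_const Complex.continuous_re
    exact ((ho1.union ho2).union ho3).union ho4
  -- both sides are analytic on `V`
  have hf : AnalyticOnNhd ℂ (mellin fnA) V := by
    refine DifferentiableOn.analyticOnNhd (fun z hz ↦ ?_) hVopen
    exact (differentiableAt_mellin_fnA (by linarith [(hVsub z hz).1])).differentiableWithinAt
  have hg : AnalyticOnNhd ℂ (fun z : ℂ ↦ (z - 1) * riemannZeta z / z ^ 2) V := by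
    refine DifferentiableOn.analyticOnNhd (fun z hz ↦ ?_) hVopen
    obtain ⟨h1, h2⟩ := hVsub z hz
    have hz0 : z ≠ 0 := fun h ↦ by rw [h, Complex.zero_re] at h1; linarith
    exact (((differentiableAt_id.sub_const 1).mul (differentiableAt_riemannZeta h2)).div
      (differentiableAt_id.pow 2) (pow_ne_zero 2 hz0)).differentiableWithinAt
  -- they agree near `3/4`
  have h34 : (3 / 4 : ℂ) ∈ V := by
    simp only [hV, Set.mem_union, Set.mem_setOf_eq]
    exact Or.inl (Or.inl (Or.inl ⟨by norm_num, by norm_num⟩))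
  have hstrip : IsOpen {z : ℂ | 1 / 2 < z.re ∧ z.re < 1} :=
    (isOpen_lt continuous_const Complex.continuous_re).inter
      (isOpen_lt Complex.continuous_re continuous_const)
  have hev : mellin fnA =ᶠ[𝓝 (3 / 4 : ℂ)] (fun z : ℂ ↦ (z - 1) * riemannZeta z / z ^ 2) := by
    filter_upwards [hstrip.mem_nhds (show (3 / 4 : ℂ) ∈ {z : ℂ | 1 / 2 < z.re ∧ z.re < 1} by
      simp only [Set.mem_setOf_eq]; norm_num)] with z hz
    exact mellin_fnA_eq_of_mem_strip hz.1 hz.2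
  exact hf.eqOn_of_preconnected_of_eventuallyEq hg isPreconnected_halfPlane_diff_one h34 hev hsV

/-- **`((s−1)/s)·ζ(s)/s ∈ ℍ²`, pole-tolerant form**: there is `F ∈ ℍ²(Re s > 1/2)` with
`F(s) = ((s−1)/s)·ζ(s)/s` for `Re s > 1/2`, `s ≠ 1` (namely `F = Â`; at `s = 1` the printed function
has a removable singularity, value `1`). "This is well-known to be true of `((s−1)/s)ζ(s)/s`."
[cite: Burnol2004b, Prop. 4.2, proof (arXiv:math/0203120v7 p. 8, TeX l.698–701)] -/
theorem exists_isHardyRight_zeta_div :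
    ∃ F : ℂ → ℂ, IsHardyRight F ∧
      ∀ s : ℂ, 1 / 2 < s.re → s ≠ 1 → F s = (s - 1) / s * (riemannZeta s / s) := by
  refine ⟨mellin fnA, isHardyRight_mellin_fnA, fun s hs hs1 ↦ ?_⟩
  have hs0 : s ≠ 0 := fun h ↦ by rw [h, Complex.zero_re] at hs; linarith
  rw [mellin_fnA_eq hs hs1]
  field_simp

/-- **`((s−1)/s)·ζ(s)/s^l ∈ ℍ²` for every `l ≥ 1`, pole-tolerant form** ("hence it holds also for
`((s−1)/s)ζ(s)/s^l`": divide `l − 1` more times by `s`, `IsHardyRight.div_id`).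
[cite: Burnol2004b, Prop. 4.2, proof (arXiv:math/0203120v7 p. 8, TeX l.700–701)] -/
theorem exists_isHardyRight_zeta_div_pow {l : ℕ} (hl : 1 ≤ l) :
    ∃ F : ℂ → ℂ, IsHardyRight F ∧
      ∀ s : ℂ, 1 / 2 < s.re → s ≠ 1 → F s = (s - 1) / s * (riemannZeta s / s ^ l) := by
  induction l, hl using Nat.le_induction with
  | base => simpa using exists_isHardyRight_zeta_div
  | succ n hn ih =>
    obtain ⟨F, hF, hFeq⟩ := ih
    refine ⟨fun s ↦ F s / s, hF.div_id, fun s hs hs1 ↦ ?_⟩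
    have hs0 : s ≠ 0 := fun h ↦ by rw [h, Complex.zero_re] at hs; linarith
    show F s / s = _
    rw [hFeq s hs hs1, pow_succ]
    field_simp

/-! ## `ζ(s)/(s−ρ)^l` at a zero of order `≥ l`: analyticity and `((s−1)/s)·ζ(s)/(s−ρ)^l ∈ ℍ²` -/

/-- `l`-th derivative at `ρ` of `(z−ρ)^l·g(z)` for `g` differentiable near `ρ`: `l!·g(ρ)`. [folklore] -/
private theorem iteratedDeriv_pow_mul {ρ : ℂ} :
    ∀ (l : ℕ) {g : ℂ → ℂ}, AnalyticAt ℂ g ρ →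
      iteratedDeriv l (fun z ↦ (z - ρ) ^ l * g z) ρ = (l.factorial : ℂ) * g ρ := by
  intro l
  induction l with
  | zero => intro g _; simp
  | succ n ih =>
    intro g hg
    -- `deriv ((z−ρ)^{n+1} g) = (z−ρ)^n · ((n+1) g + (z−ρ) g')` near `ρ`
    obtain ⟨r, hr, hgr⟩ : ∃ r > 0, ∀ z ∈ Metric.ball ρ r, AnalyticAt ℂ g z :=
      Metric.eventually_nhds_iff_ball.1 hg.eventually_analyticAt
    set g₁ : ℂ → ℂ := fun z ↦ ((n : ℂ) + 1) * g z + (z - ρ) * deriv g z with hg₁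
    have hg₁a : AnalyticAt ℂ g₁ ρ := by
      have h1 : AnalyticAt ℂ (fun z : ℂ ↦ z - ρ) ρ := analyticAt_id.sub analyticAt_const
      exact (analyticAt_const.mul hg).add (h1.mul hg.deriv)
    have hderiv : deriv (fun z ↦ (z - ρ) ^ (n + 1) * g z) =ᶠ[𝓝 ρ]
        fun z ↦ (z - ρ) ^ n * g₁ z := by
      filter_upwards [Metric.ball_mem_nhds ρ hr] with z hz
      have hgz : DifferentiableAt ℂ g z := (hgr z hz).differentiableAt
      have hp : HasDerivAt (fun z : ℂ ↦ (z - ρ) ^ (n + 1)) (((n : ℂ) + 1) * (z - ρ) ^ n) z := by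
        have h1 : HasDerivAt (fun z : ℂ ↦ z - ρ) 1 z := (hasDerivAt_id z).sub_const ρ
        have h2 : HasDerivAt (fun z : ℂ ↦ (z - ρ) ^ (n + 1))
            (((n + 1 : ℕ) : ℂ) * (z - ρ) ^ (n + 1 - 1) * 1) z := h1.pow (n + 1)
        simpa using h2
      have hprod : HasDerivAt (fun z : ℂ ↦ (z - ρ) ^ (n + 1) * g z)
          (((n : ℂ) + 1) * (z - ρ) ^ n * g z + (z - ρ) ^ (n + 1) * deriv g z) z :=
        hp.mul hgz.hasDerivAt
      rw [hprod.deriv, hg₁]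
      ring
    rw [iteratedDeriv_succ', hderiv.iteratedDeriv_eq, ih hg₁a, hg₁]
    simp only [sub_self, zero_mul, add_zero]
    push_cast [Nat.factorial_succ]
    ring

/-- `ζ(s)/(s−ρ)^l` off `ρ`. [cite: Burnol2004b, Thm. 3.3 (arXiv:math/0203120v7 p. 7, TeX l.587–594)] -/
theorem zetaOverPow_of_ne {ρ s : ℂ} {l : ℕ} (h : s ≠ ρ) :
    zetaOverPow ρ l s = riemannZeta s / (s - ρ) ^ l := by
  rw [zetaOverPow, if_neg h]

/-- **`ζ(s)/(s−ρ)^l`, filled in at `ρ` by `ζ^{(l)}(ρ)/l!`, is analytic at `ρ`** when `ζ` vanishes to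
order `≥ l` at `ρ ≠ 1` ("the removable singularity at `s = ρ` filled in by the limit value").
[cite: Burnol2004b, Thm. 3.3 and Prop. 4.2 (arXiv:math/0203120v7 pp. 7–8, TeX l.587–594, 695–707)] -/
theorem analyticAt_zetaOverPow {ρ : ℂ} {l : ℕ} (hρ1 : ρ ≠ 1)
    (hord : (l : ℕ∞) ≤ analyticOrderAt riemannZeta ρ) : AnalyticAt ℂ (zetaOverPow ρ l) ρ := by
  have hζ : AnalyticAt ℂ riemannZeta ρ := analyticOn_riemannZeta ρ hρ1
  obtain ⟨g, hg, hfg⟩ := (natCast_le_analyticOrderAt hζ).1 hord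
  have hfg' : riemannZeta =ᶠ[𝓝 ρ] fun z ↦ (z - ρ) ^ l * g z := by
    filter_upwards [hfg] with z hz; rw [hz, smul_eq_mul]
  have hfill : iteratedDeriv l riemannZeta ρ = (l.factorial : ℂ) * g ρ := by
    rw [hfg'.iteratedDeriv_eq, iteratedDeriv_pow_mul l hg]
  have heq : zetaOverPow ρ l =ᶠ[𝓝 ρ] g := by
    filter_upwards [hfg] with z hz
    by_cases h : z = ρ
    · subst h
      rw [zetaOverPow, if_pos rfl, hfill]
      have : (l.factorial : ℂ) ≠ 0 := by exact_mod_cast l.factorial_ne_zero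
      field_simp
    · rw [zetaOverPow_of_ne h, hz, smul_eq_mul]
      have : (z - ρ) ^ l ≠ 0 := pow_ne_zero _ (sub_ne_zero.2 h)
      field_simp
  exact hg.congr heq.symm

/-- `ζ(s)/(s−ρ)^l` (filled in) is holomorphic on `ℂ ∖ {1}` when `ζ` vanishes to order `≥ l` at `ρ ≠ 1`.
[cite: Burnol2004b, Thm. 3.3 and Prop. 4.2 (arXiv:math/0203120v7 pp. 7–8, TeX l.587–594, 695–707)] -/
theorem differentiableOn_zetaOverPow {ρ : ℂ} {l : ℕ} (hρ1 : ρ ≠ 1)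
    (hord : (l : ℕ∞) ≤ analyticOrderAt riemannZeta ρ) :
    DifferentiableOn ℂ (zetaOverPow ρ l) {s | s ≠ 1} := by
  intro s hs
  by_cases h : s = ρ
  · subst h
    exact (analyticAt_zetaOverPow hρ1 hord).differentiableAt.differentiableWithinAt
  · -- near `s ≠ ρ`, `zetaOverPow = ζ/(z−ρ)^l`
    have hev : zetaOverPow ρ l =ᶠ[𝓝 s] fun z ↦ riemannZeta z / (z - ρ) ^ l := by
      filter_upwards [isOpen_ne.mem_nhds h] with z hz
      exact zetaOverPow_of_ne hz
    have hd : DifferentiableAt ℂ (fun z ↦ riemannZeta z / (z - ρ) ^ l) s :=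
      (differentiableAt_riemannZeta hs).div ((differentiableAt_id.sub_const ρ).pow l)
        (pow_ne_zero _ (sub_ne_zero.2 h))
    exact (hev.differentiableAt_iff.2 hd).differentiableWithinAt

/-- **`((s−1)/s)·ζ(s)/(s−ρ)^l ∈ ℍ²(Re s > 1/2)`, pole-tolerant form**, for `ρ` in the critical
strip with `ζ` vanishing to order `≥ l ≥ 1` at `ρ`: there is `G ∈ ℍ²` with
`G(s) = ((s−1)/s)·ζ(s)/(s−ρ)^l` (filled in at `ρ`) for `Re s > 1/2`, `s ≠ 1`. Printed argument: this
holds for `((s−1)/s)ζ(s)/s^l`, and "if we exclude a neigborhood of `ρ` then `s^l/(s−ρ)^l` is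
bounded, so going back to the definition of `ℍ²` as a space of analytic functions in the right
half-plane with a uniform bound of their `L²` norms on vertical lines we obtain the desired
conclusion" (`IsHardyRight.of_le_off_rect'`, the rectangle `[Re ρ/2, (Re ρ+1)/2] × [−|Im ρ|−1, |Im ρ|+1]`
avoiding `0` and `1`). [cite: Burnol2004b, Prop. 4.2, proof (arXiv:math/0203120v7 p. 8, TeX l.695–707)] -/
theorem exists_isHardyRight_zetaOverPow {ρ : ℂ} {l : ℕ} (hl : 1 ≤ l) (hρ0 : 0 < ρ.re)
    (hρ1 : ρ.re < 1) (hord : (l : ℕ∞) ≤ analyticOrderAt riemannZeta ρ) :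
    ∃ G : ℂ → ℂ, IsHardyRight G ∧
      ∀ s : ℂ, 1 / 2 < s.re → s ≠ 1 → G s = (s - 1) / s * zetaOverPow ρ l s := by
  have hρne1 : ρ ≠ 1 := fun h ↦ by rw [h, Complex.one_re] at hρ1; exact lt_irrefl _ hρ1
  have hρne0 : ρ ≠ 0 := fun h ↦ by rw [h, Complex.zero_re] at hρ0; exact lt_irrefl _ hρ0
  obtain ⟨F, hF, hFeq⟩ := exists_isHardyRight_zeta_div_pow hl
  set G : ℂ → ℂ := fun s ↦ if s = 1 then F 1 / (1 - ρ) ^ l else (s - 1) / s * zetaOverPow ρ l s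
    with hG
  refine ⟨G, ?_, fun s hs hs1 ↦ by simp only [hG, if_neg hs1]⟩
  have hopen : IsOpen {s : ℂ | 1 / 2 < s.re} := isOpen_lt continuous_const Complex.continuous_re
  -- `Φ := (s−1)/s · zetaOverPow` is holomorphic off `{0, 1}`
  have hΦ : DifferentiableOn ℂ (fun s ↦ (s - 1) / s * zetaOverPow ρ l s) {s | s ≠ 0 ∧ s ≠ 1} := by
    intro s hs
    have h1 : DifferentiableAt ℂ (fun s : ℂ ↦ (s - 1) / s) s :=
      (differentiableAt_id.sub_const 1).div differentiableAt_id hs.1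
    have h2 : DifferentiableAt ℂ (zetaOverPow ρ l) s :=
      (differentiableOn_zetaOverPow hρne1 hord s hs.2).differentiableAt (isOpen_ne.mem_nhds hs.2)
    exact (h1.mul h2).differentiableWithinAt
  have hopen01 : IsOpen {s : ℂ | s ≠ 0 ∧ s ≠ 1} := isOpen_ne.inter isOpen_ne
  -- off `ρ`: `G = F · s^l/(s−ρ)^l` on the half-plane
  have hGF : ∀ s : ℂ, 1 / 2 < s.re → s ≠ ρ → G s = F s * (s ^ l / (s - ρ) ^ l) := by
    intro s hs hsρ
    have hs0 : s ≠ 0 := fun h ↦ by rw [h, Complex.zero_re] at hs; linarith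
    have hpow : (s - ρ) ^ l ≠ 0 := pow_ne_zero _ (sub_ne_zero.2 hsρ)
    by_cases hs1 : s = 1
    · subst hs1
      simp only [hG, if_true, one_pow]
      ring
    · simp only [hG, if_neg hs1]
      rw [zetaOverPow_of_ne hsρ, hFeq s hs hs1]
      have : s ^ l ≠ 0 := pow_ne_zero _ hs0
      field_simp
  -- holomorphy of `G` on the half-plane
  have hGd : DifferentiableOn ℂ G {s | 1 / 2 < s.re} := by
    intro s hs
    have hs' : 1 / 2 < s.re := hs
    have hs0 : s ≠ 0 := fun h ↦ by rw [h, Complex.zero_re] at hs'; linarith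
    by_cases hs1 : s = 1
    · have hsρ : s ≠ ρ := by rw [hs1]; exact hρne1.symm
      have hev : G =ᶠ[𝓝 s] fun z ↦ F z * (z ^ l / (z - ρ) ^ l) := by
        filter_upwards [isOpen_ne.mem_nhds hsρ, hopen.mem_nhds hs'] with z hz hz'
        exact hGF z hz' hz
      have hFd : DifferentiableAt ℂ F s := (hF.1 s hs').differentiableAt (hopen.mem_nhds hs')
      have hφ : DifferentiableAt ℂ (fun z : ℂ ↦ z ^ l / (z - ρ) ^ l) s :=
        (differentiableAt_id.pow l).div ((differentiableAt_id.sub_const ρ).pow l)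
          (pow_ne_zero _ (sub_ne_zero.2 hsρ))
      exact (hev.differentiableAt_iff.2 (hFd.mul hφ)).differentiableWithinAt
    · have hev : G =ᶠ[𝓝 s] fun z ↦ (z - 1) / z * zetaOverPow ρ l z := by
        filter_upwards [isOpen_ne.mem_nhds hs1] with z hz
        simp only [hG, if_neg hz]
      have hd := (hΦ s ⟨hs0, hs1⟩).differentiableAt (hopen01.mem_nhds ⟨hs0, hs1⟩)
      exact (hev.differentiableAt_iff.2 hd).differentiableWithinAt
  -- the rectangle around `ρ`, avoiding `0` and `1`
  set σ₁ : ℝ := ρ.re / 2 with hσ₁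
  set σ₂ : ℝ := (ρ.re + 1) / 2 with hσ₂
  set R : ℝ := |ρ.im| + 1 with hR
  set d : ℝ := min (min ((1 - ρ.re) / 2) (ρ.re / 2)) 1 with hd
  have hd0 : 0 < d := by
    rw [hd]; exact lt_min (lt_min (by linarith) (by linarith)) one_pos
  have hR0 : 0 ≤ R := by rw [hR]; positivity
  -- bound on the compact rectangle
  set K : Set ℂ := Set.Icc σ₁ σ₂ ×ℂ Set.Icc (-R) R with hK
  have hKc : IsCompact K := isCompact_Icc.reProdIm isCompact_Icc
  have hKsub : K ⊆ {s : ℂ | s ≠ 0 ∧ s ≠ 1} := by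
    intro s hs
    obtain ⟨⟨h1, h2⟩, -⟩ := Complex.mem_reProdIm.1 hs
    constructor
    · intro h; rw [h, Complex.zero_re] at h1; rw [hσ₁] at h1; linarith
    · intro h; rw [h, Complex.one_re] at h2; rw [hσ₂] at h2; linarith
  obtain ⟨M₀, hM₀⟩ := hKc.exists_bound_of_continuousOn (hΦ.continuousOn.mono hKsub)
  have hMK : ∀ s : ℂ, 1 / 2 < s.re → σ₁ ≤ s.re → s.re ≤ σ₂ → |s.im| ≤ R →
      ‖G s‖ ≤ max M₀ 0 := by
    intro s _ h1 h2 h3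
    have hs1 : s ≠ 1 := by intro h; rw [h, Complex.one_re] at h2; rw [hσ₂] at h2; linarith
    have hsK : s ∈ K := Complex.mem_reProdIm.2 ⟨⟨h1, h2⟩, abs_le.1 h3⟩
    simp only [hG, if_neg hs1]
    exact (hM₀ s hsK).trans (le_max_left _ _)
  -- off the rectangle: `|s − ρ| ≥ d` and `‖s^l/(s−ρ)^l‖ ≤ (1 + ‖ρ‖/d)^l`
  have hfar : ∀ s : ℂ, (s.re < σ₁ ∨ σ₂ < s.re ∨ R < |s.im|) → d ≤ ‖s - ρ‖ := by
    intro s hs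
    have hre : |(s - ρ).re| ≤ ‖s - ρ‖ := Complex.abs_re_le_norm _
    have him : |(s - ρ).im| ≤ ‖s - ρ‖ := Complex.abs_im_le_norm _
    rw [Complex.sub_re] at hre
    rw [Complex.sub_im] at him
    have hd1 : d ≤ (1 - ρ.re) / 2 := (min_le_left _ _).trans (min_le_left _ _)
    have hd2 : d ≤ ρ.re / 2 := (min_le_left _ _).trans (min_le_right _ _)
    have hd3 : d ≤ 1 := min_le_right _ _
    rcases hs with h | h | h
    · rw [hσ₁] at h
      have : ρ.re / 2 ≤ |s.re - ρ.re| := by rw [abs_sub_comm, abs_of_pos (by linarith)]; linarith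
      linarith
    · rw [hσ₂] at h
      have : (1 - ρ.re) / 2 ≤ |s.re - ρ.re| := by rw [abs_of_pos (by linarith)]; linarith
      linarith
    · rw [hR] at h
      have : 1 ≤ |s.im - ρ.im| := by
        have := abs_sub_abs_le_abs_sub s.im ρ.im
        linarith
      linarith
  set C : ℝ := (1 + ‖ρ‖ / d) ^ l with hC
  have hC0 : 0 ≤ C := by rw [hC]; positivity
  have hb : ∀ s : ℂ, 1 / 2 < s.re → (s.re < σ₁ ∨ σ₂ < s.re ∨ R < |s.im|) →
      ‖G s‖ ≤ C * ‖F s‖ := by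
    intro s hs hout
    have hsρ' : d ≤ ‖s - ρ‖ := hfar s hout
    have hsρ0 : 0 < ‖s - ρ‖ := lt_of_lt_of_le hd0 hsρ'
    have hsρ : s ≠ ρ := fun h ↦ by rw [h, sub_self, norm_zero] at hsρ0; exact lt_irrefl _ hsρ0
    rw [hGF s hs hsρ, norm_mul, mul_comm]
    refine mul_le_mul_of_nonneg_right ?_ (norm_nonneg _)
    -- `‖s^l/(s−ρ)^l‖ = ‖s/(s−ρ)‖^l ≤ (1 + ‖ρ‖/d)^l`
    have hq : ‖s / (s - ρ)‖ ≤ 1 + ‖ρ‖ / d := by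
      have hsplit : s / (s - ρ) = 1 + ρ / (s - ρ) := by
        field_simp [sub_ne_zero.2 hsρ]
        ring
      rw [hsplit]
      calc ‖1 + ρ / (s - ρ)‖ ≤ ‖(1 : ℂ)‖ + ‖ρ / (s - ρ)‖ := norm_add_le _ _
        _ = 1 + ‖ρ‖ / ‖s - ρ‖ := by rw [norm_one, norm_div]
        _ ≤ 1 + ‖ρ‖ / d := by gcongr
    calc ‖s ^ l / (s - ρ) ^ l‖ = ‖s / (s - ρ)‖ ^ l := by rw [← div_pow, norm_pow]
      _ ≤ (1 + ‖ρ‖ / d) ^ l := pow_le_pow_left₀ (norm_nonneg _) hq l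
      _ = C := by rw [hC]
  exact hF.of_le_off_rect' hGd hR0 hC0 (le_max_right M₀ 0) hMK hb

/-! ## The "Fourier transform" side and Prop. 4.2 from Prop. 4.1 (ii) -/

/-- From the `ℤ`-valued multiplicity `m(ρ) ≥ l` (`riemannZetaZeroOrder`) to `l ≤ analyticOrderAt ζ ρ`
(`ρ ≠ 1`). [cite: Burnol2004b, Thm. 3.3 (arXiv:math/0203120v7 p. 7, TeX l.587–594)] -/
theorem natCast_le_analyticOrderAt_zeta {ρ : ℂ} {l : ℕ} (hρ1 : ρ ≠ 1)
    (h : (l : ℤ) ≤ riemannZetaZeroOrder ρ) : (l : ℕ∞) ≤ analyticOrderAt riemannZeta ρ := by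
  have ha : AnalyticAt ℂ riemannZeta ρ := analyticOn_riemannZeta ρ hρ1
  cases hn : analyticOrderAt riemannZeta ρ with
  | top => exact le_top
  | coe n =>
    rw [riemannZetaZeroOrder, ha.meromorphicOrderAt_eq, hn, ENat.map_coe, WithTop.untop₀_coe] at h
    exact_mod_cast h

/-- `Γ_ℝ` is continuous where it does not vanish (`1/Γ_ℝ` is entire). [folklore] -/
private theorem continuousAt_Gammaℝ {z : ℂ} (hz : Gammaℝ z ≠ 0) : ContinuousAt Gammaℝ z := by
  have h := (differentiable_Gammaℝ_inv.differentiableAt (x := z)).continuousAt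
  have h2 := h.inv₀ (inv_ne_zero hz)
  have h3 : (fun s : ℂ ↦ ((Gammaℝ s)⁻¹)⁻¹) = Gammaℝ := by funext s; simp
  have h4 : ContinuousAt (fun s : ℂ ↦ ((Gammaℝ s)⁻¹)⁻¹) z := h2
  rwa [h3] at h4

/-- **The "Fourier transform" side of Prop. 4.2**: with `G = ζ(s)/(s−ρ)^l` and
`H = (−1)^l ζ(s)/(s−(1−ρ))^l` (both filled in), `Γ_ℝ(s)H(s) = Γ_ℝ(1−s)G(1−s)` off the poles of the
two Gamma factors — Burnol's "`χ(s)F(1−s) = (−1)^l ζ(s)/(s−(1−ρ))^l`" written through the completed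
zeta function `Λ(s) = Γ_ℝ(s)ζ(s) = Λ(1−s)`; at `s = 1−ρ` by continuity. Here `0 < Re ρ < 1` and `ζ`
vanishes to order `≥ l` at `ρ` and at `1−ρ`.
[cite: Burnol2004b, Prop. 4.2, proof (arXiv:math/0203120v7 p. 8, TeX l.695–698)] -/
theorem Gammaℝ_mul_zetaOverPow_reflect {ρ : ℂ} {l : ℕ} (hρ0 : 0 < ρ.re) (hρ1 : ρ.re < 1)
    (hord : (l : ℕ∞) ≤ analyticOrderAt riemannZeta ρ)
    (hord' : (l : ℕ∞) ≤ analyticOrderAt riemannZeta (1 - ρ)) (s : ℂ)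
    (hs0 : ∀ n : ℕ, s ≠ -2 * (n : ℂ)) (hs1 : ∀ n : ℕ, s ≠ 1 + 2 * (n : ℂ)) :
    Gammaℝ s * ((-1) ^ l * zetaOverPow (1 - ρ) l s) =
      Gammaℝ (1 - s) * zetaOverPow ρ l (1 - s) := by
  have hρne1 : ρ ≠ 1 := fun h ↦ by rw [h, Complex.one_re] at hρ1; exact lt_irrefl _ hρ1
  have hρne0 : ρ ≠ 0 := fun h ↦ by rw [h, Complex.zero_re] at hρ0; exact lt_irrefl _ hρ0
  have h1ρne1 : 1 - ρ ≠ 1 := fun h ↦ hρne0 (by simpa using h)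
  have hunit : ((-1 : ℂ) ^ l) * (-1) ^ l = 1 := by rw [← mul_pow]; simp
  -- the identity off the poles and off `s = 1 − ρ`
  have key : ∀ z : ℂ, (∀ n : ℕ, z ≠ -2 * (n : ℂ)) → (∀ n : ℕ, z ≠ 1 + 2 * (n : ℂ)) → z ≠ 1 - ρ →
      Gammaℝ z * ((-1) ^ l * zetaOverPow (1 - ρ) l z) =
        Gammaℝ (1 - z) * zetaOverPow ρ l (1 - z) := by
    intro z hz0 hz1 hzρ
    have hzne0 : z ≠ 0 := by simpa using hz0 0
    have h1z : 1 - z ≠ 0 := sub_ne_zero.2 (fun h ↦ hz1 0 (by simp [← h]))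
    have hG1 : Gammaℝ z ≠ 0 := by
      rw [Ne, Gammaℝ_eq_zero_iff]; push Not; intro n h
      exact hz0 n (by rw [h]; ring)
    have hG2 : Gammaℝ (1 - z) ≠ 0 := by
      rw [Ne, Gammaℝ_eq_zero_iff]; push Not; intro n h
      exact hz1 n (by linear_combination -h)
    have hΛ : Gammaℝ z * riemannZeta z = completedRiemannZeta z := by
      rw [riemannZeta_def_of_ne_zero hzne0]; field_simp
    have hΛ' : Gammaℝ (1 - z) * riemannZeta (1 - z) = completedRiemannZeta z := by
      rw [riemannZeta_def_of_ne_zero h1z, completedRiemannZeta_one_sub]; field_simp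
    have h1zρ : 1 - z ≠ ρ := fun h ↦ hzρ (by rw [← h]; ring)
    have hD : (z - (1 - ρ)) ^ l ≠ 0 := pow_ne_zero _ (sub_ne_zero.2 hzρ)
    have hpow : (1 - z - ρ) ^ l = (-1) ^ l * (z - (1 - ρ)) ^ l := by
      rw [show (1 - z - ρ) = -(z - (1 - ρ)) by ring]; exact neg_pow _ _
    rw [zetaOverPow_of_ne hzρ, zetaOverPow_of_ne h1zρ, hpow]
    have hD' : (-1) ^ l * (z - (1 - ρ)) ^ l ≠ 0 := mul_ne_zero (pow_ne_zero _ (by norm_num)) hD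
    rw [show Gammaℝ z * ((-1) ^ l * (riemannZeta z / (z - (1 - ρ)) ^ l)) =
        (-1) ^ l * (Gammaℝ z * riemannZeta z) / (z - (1 - ρ)) ^ l by ring,
      show Gammaℝ (1 - z) * (riemannZeta (1 - z) / ((-1) ^ l * (z - (1 - ρ)) ^ l)) =
        (Gammaℝ (1 - z) * riemannZeta (1 - z)) / ((-1) ^ l * (z - (1 - ρ)) ^ l) by ring,
      hΛ, hΛ', div_eq_div_iff hD hD']
    calc (-1) ^ l * completedRiemannZeta z * ((-1) ^ l * (z - (1 - ρ)) ^ l)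
        = ((-1 : ℂ) ^ l * (-1) ^ l) * (completedRiemannZeta z * (z - (1 - ρ)) ^ l) := by ring
      _ = completedRiemannZeta z * (z - (1 - ρ)) ^ l := by rw [hunit, one_mul]
  by_cases hsρ : s = 1 - ρ
  swap
  · exact key s hs0 hs1 hsρ
  -- at `s = 1 − ρ`: both sides are continuous there and agree on a punctured neighbourhood
  subst hsρ
  set Φ₁ : ℂ → ℂ := fun z ↦ Gammaℝ z * ((-1) ^ l * zetaOverPow (1 - ρ) l z) with hΦ₁
  set Φ₂ : ℂ → ℂ := fun z ↦ Gammaℝ (1 - z) * zetaOverPow ρ l (1 - z) with hΦ₂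
  change Φ₁ (1 - ρ) = Φ₂ (1 - ρ)
  have hre : (1 - ρ).re = 1 - ρ.re := by simp
  have hGs : Gammaℝ (1 - ρ) ≠ 0 := Gammaℝ_ne_zero_of_re_pos (by rw [hre]; linarith)
  have hGρ : Gammaℝ ρ ≠ 0 := Gammaℝ_ne_zero_of_re_pos hρ0
  have hsub : ContinuousAt (fun z : ℂ ↦ 1 - z) (1 - ρ) := (continuous_const.sub continuous_id).continuousAt
  have h1 : ContinuousAt Φ₁ (1 - ρ) := by
    refine (continuousAt_Gammaℝ hGs).mul (continuousAt_const.mul ?_)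
    exact (analyticAt_zetaOverPow h1ρne1 hord').continuousAt
  have h2 : ContinuousAt Φ₂ (1 - ρ) := by
    refine ContinuousAt.mul ?_ ?_
    · exact ContinuousAt.comp_of_eq (continuousAt_Gammaℝ hGρ) hsub (by ring)
    · exact ContinuousAt.comp_of_eq (analyticAt_zetaOverPow hρne1 hord).continuousAt hsub (by ring)
  -- punctured neighbourhood inside the critical strip
  set r : ℝ := min (1 - ρ.re) ρ.re with hr
  have hr0 : 0 < r := lt_min (by linarith) hρ0
  have hev : ∀ᶠ z in 𝓝[≠] (1 - ρ), Φ₁ z = Φ₂ z := by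
    have hball : Metric.ball (1 - ρ) r ∈ 𝓝 (1 - ρ) := Metric.ball_mem_nhds _ hr0
    filter_upwards [self_mem_nhdsWithin, mem_nhdsWithin_of_mem_nhds hball] with z hz hzb
    have hdist : ‖z - (1 - ρ)‖ < r := by rwa [Metric.mem_ball, dist_eq_norm] at hzb
    have hzre : |z.re - (1 - ρ.re)| < r := by
      have := Complex.abs_re_le_norm (z - (1 - ρ))
      rw [Complex.sub_re, hre] at this
      exact lt_of_le_of_lt this hdist
    have hr1 : r ≤ 1 - ρ.re := min_le_left _ _
    have hr2 : r ≤ ρ.re := min_le_right _ _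
    have hzpos : 0 < z.re := by
      have := (abs_lt.1 hzre).1; linarith
    have hzlt1 : z.re < 1 := by
      have := (abs_lt.1 hzre).2; linarith
    refine key z (fun n h ↦ ?_) (fun n h ↦ ?_) hz
    · have := congrArg Complex.re h
      simp at this; linarith [Nat.cast_nonneg (α := ℝ) n]
    · have := congrArg Complex.re h
      simp at this; linarith [Nat.cast_nonneg (α := ℝ) n]
  have t1 : Tendsto Φ₁ (𝓝[≠] (1 - ρ)) (𝓝 (Φ₁ (1 - ρ))) := h1.tendsto.mono_left nhdsWithin_le_nhds
  have t2 : Tendsto Φ₂ (𝓝[≠] (1 - ρ)) (𝓝 (Φ₂ (1 - ρ))) := h2.tendsto.mono_left nhdsWithin_le_nhds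
  exact tendsto_nhds_unique (t1.congr' hev) t2


/-- **Prop. 4.2 from clause (ii) of the repaired Prop. 4.1 alone** (the Paley–Wiener step; clauses
(i) and (iii) of `Burnol2004b_prop4_1R` are not used): `ζ(s)/(s−ρ)^l ∈ L̂_1` for `1 ≤ l ≤ m_ρ`. This is the
form to instantiate with a free-standing proof of clause (ii).
[cite: Burnol2004b, Prop. 4.2 and its proof (arXiv:math/0203120v7 p. 8, TeX l.688–707)] -/
theorem Burnol2004b_prop4_2_of_prop4_1R_ii
    (hii : ∀ a : ℝ, 0 < a → ∀ G H : ℂ → ℂ,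
      DifferentiableOn ℂ G {s | s ≠ 1} → DifferentiableOn ℂ H {s | s ≠ 1} →
      (∀ s : ℂ, (∀ n : ℕ, s ≠ -2 * (n : ℂ)) → (∀ n : ℕ, s ≠ 1 + 2 * (n : ℂ)) →
        Gammaℝ s * H s = Gammaℝ (1 - s) * G (1 - s)) →
      (∃ F : ℂ → ℂ, IsHardyRight F ∧ ∀ s : ℂ, 1 / 2 < s.re → s ≠ 1 →
        F s = (a : ℂ) ^ s * ((s - 1) / s) * G s) →
      (∃ F : ℂ → ℂ, IsHardyRight F ∧ ∀ s : ℂ, 1 / 2 < s.re → s ≠ 1 →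
        F s = (a : ℂ) ^ s * ((s - 1) / s) * H s) →
      ∃ f ∈ sonineL a, ∀ s : ℂ, 1 / 2 < s.re → s.re < 1 → rightMellin f s = G s) :
    Burnol2004b_prop4_2 := by
  intro ρ hρ l hl hlm
  obtain ⟨hζ, hρ0, hρ1⟩ := mem_riemannZetaNontrivialZeros_iff_holds.1 hρ
  have hρne1 : ρ ≠ 1 := fun h ↦ by rw [h, Complex.one_re] at hρ1; exact lt_irrefl _ hρ1
  have hρne0 : ρ ≠ 0 := fun h ↦ by rw [h, Complex.zero_re] at hρ0; exact lt_irrefl _ hρ0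
  have h1ρne1 : 1 - ρ ≠ 1 := fun h ↦ hρne0 (by simpa using h)
  have h1ρ0 : 0 < (1 - ρ).re := by simp; linarith
  have h1ρ1 : (1 - ρ).re < 1 := by simp; linarith
  have hord : (l : ℕ∞) ≤ analyticOrderAt riemannZeta ρ := natCast_le_analyticOrderAt_zeta hρne1 hlm
  have hord' : (l : ℕ∞) ≤ analyticOrderAt riemannZeta (1 - ρ) :=
    natCast_le_analyticOrderAt_zeta h1ρne1 (by rwa [riemannZetaZeroOrder_one_sub_holds hρ0 hρ1])
  have h2 := hii 1 one_pos
  -- the two ℍ² members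
  obtain ⟨G₁, hG₁, hG₁eq⟩ := exists_isHardyRight_zetaOverPow hl hρ0 hρ1 hord
  obtain ⟨G₂, hG₂, hG₂eq⟩ := exists_isHardyRight_zetaOverPow hl h1ρ0 h1ρ1 hord'
  have hFG : ∃ F : ℂ → ℂ, IsHardyRight F ∧ ∀ s : ℂ, 1 / 2 < s.re → s ≠ 1 →
      F s = ((1 : ℝ) : ℂ) ^ s * ((s - 1) / s) * zetaOverPow ρ l s :=
    ⟨G₁, hG₁, fun s hs hs1 ↦ by rw [hG₁eq s hs hs1]; push_cast; rw [one_cpow]; ring⟩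
  have hFH : ∃ F : ℂ → ℂ, IsHardyRight F ∧ ∀ s : ℂ, 1 / 2 < s.re → s ≠ 1 →
      F s = ((1 : ℝ) : ℂ) ^ s * ((s - 1) / s) * ((-1) ^ l * zetaOverPow (1 - ρ) l s) :=
    ⟨fun s ↦ (-1) ^ l * G₂ s, hG₂.const_mul _, fun s hs hs1 ↦ by
      show (-1) ^ l * G₂ s = _
      rw [hG₂eq s hs hs1]; push_cast; rw [one_cpow]; ring⟩
  obtain ⟨f, hf, hfeq⟩ := h2 (zetaOverPow ρ l) (fun s ↦ (-1) ^ l * zetaOverPow (1 - ρ) l s)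
    (differentiableOn_zetaOverPow hρne1 hord)
    ((differentiableOn_zetaOverPow h1ρne1 hord').const_mul _)
    (fun s hs0 hs1 ↦ Gammaℝ_mul_zetaOverPow_reflect hρ0 hρ1 hord hord' s hs0 hs1) hFG hFH
  exact ⟨f, hf, hfeq⟩

/-- **Prop. 4.2 from Prop. 4.1 (ii)** (the printed proof, assembled): given the repaired Prop. 4.1
(`Burnol2004b_prop4_1R`, whose clause (ii) is the Paley–Wiener step), the functions `ζ(s)/(s−ρ)^l`,
`1 ≤ l ≤ m_ρ`, belong to `L̂_1` — with `a = 1`, `G = ζ(s)/(s−ρ)^l`, `H = (−1)^l ζ(s)/(s−(1−ρ))^l`, the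
`ℍ²`-memberships `exists_isHardyRight_zetaOverPow` (at `ρ` and at `1−ρ`, a zero of the same order by
`riemannZetaZeroOrder_one_sub_holds`) and the `Γ_ℝ`-relation `Gammaℝ_mul_zetaOverPow_reflect`.
[cite: Burnol2004b, Prop. 4.2 and its proof (arXiv:math/0203120v7 p. 8, TeX l.688–707)] -/
theorem Burnol2004b_prop4_2_of_prop4_1R (h41 : Burnol2004b_prop4_1R) : Burnol2004b_prop4_2 :=
  Burnol2004b_prop4_2_of_prop4_1R_ii (fun a ha ↦ (h41 a ha).2.1)

end BurnolZetaHardy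

end Literature.NumberTheory.LFunctions

end
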